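import Literature.NumberTheory.Sieve.MoebiusCharacterSums
import HarnessLib

/-!
# Vaughan's mean value theorem for the Möbius function (with a coprimality condition)

Topic `Literature/NumberTheory/Sieve`; everything in this file is PROVED (theorems only).  It is
the large-sieve half of the tree's proof of the **Bombieri–Vinogradov theorem for the Möbius
function** (`BombieriVinogradovMoebius.lean`; the case `f = μ`, and through `λ = 𝟙_□ ⋆ μ` the case
`f = λ`, of Fouvry–Tenenbaum, Trans. Amer. Math. Soc. 375 (2022), Theorem 1.8
[FouvryTenenbaum2021]), continuing `MoebiusCharacterSums.lean` exactly as `VaughanMeanValue.lean`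
continues `VaughanMeanValueDecomposition.lean` for `ψ(y, χ)`:

  `∑_{q ≤ Q} (q/φ(q)) ∑*_{χ mod q} |M_r(X(q, χ), χ)| ≤ 110000 τ(r) (Y + Y^{5/6} Q + Y^{1/2} Q²) log⁴(YQ)`

for integers `r, Q ≥ 1`, real `Y ≥ 2` and arbitrary integer cut-offs `X(q, χ) ≤ Y`
(`moebius_character_meanValue`), where `M_r(X, χ) = ∑_{n ≤ X, (n,r)=1} μ(n)χ(n)`
(`Literature.NumberTheory.Sieve.VaughanMoebius.moebiusCharSum`).

## Contents (`ℓ = 1 + log Y₀`, `Y₀ = ⌊Y⌋`, `T` = `Literature.NumberTheory.Sieve.Vaughan.Tfun`)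

* `Tfun_two_mul_P₀_le` (`T(2P₀) ≤ 2UQ²`); `norm_T₂'_le_trivial`, `norm_T₂'_le_of_isPrimitive`,
  `Tfun_T₂'_le` (`T(T₂') ≤ Y₀ℓ² + τ(r) U ℓ Q^{5/2}(1 + log Q)`, Pólya–Vinogradov with the
  coprimality condition);
* `Tfun_T₂''_le` (`≤ 160 ℓ⁴ √Y₀ (√Y₀ + UQ + Q√Y₀/√U + Q²)`, `U² ≤ Y₀`) and `Tfun_T₃_le`
  (`≤ 160 ℓ⁴ √Y₀ (√Y₀ + 2Q√Y₀/√U + Q²)`): dyadic blocks and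
  `Literature.NumberTheory.Sieve.Vaughan.Tfun_blockSum_le` (the hyperbolic large sieve);
* `Tfun_moebiusCharSum_le_of_lt_sq` (the case `Q² > Y₀`: `≤ 20 Q² √Y₀ ℓ`),
  `Tfun_moebiusCharSum_le_pieces` (the case `Q² ≤ Y₀`), and the assembly
  `Literature.NumberTheory.Sieve.moebius_character_meanValue` with `u = min(Y^{1/3}, YQ⁻²)`
  (`Literature.NumberTheory.Sieve.Vaughan.alg_W`).

No attempt is made to optimise constants or powers of logarithms.

## References

* R. C. Vaughan, *An elementary method in prime number theory*, Acta Arith. 37 (1980), 111–115,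
  Theorem 1 and §2 (the method, for `ψ(y, χ)`). [Vaughan1980]
* H. Iwaniec, E. Kowalski, *Analytic Number Theory*, AMS 2004, §13.4 (Vaughan's identity for `μ`)
  and Theorem 17.4 (the general bilinear form of the Bombieri–Vinogradov theorem).
  [IwaniecKowalski2004]
* É. Fouvry, G. Tenenbaum, Trans. Amer. Math. Soc. 375 (2022), Theorem 1.8. [FouvryTenenbaum2021]
-/

open Finset Real Complex

namespace Literature.NumberTheory.Sieve.VaughanMoebius

open ArithmeticFunction LargeSieve Vaughan
open scoped ArithmeticFunction.Moebius ArithmeticFunction.zeta ArithmeticFunction.sigma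

/-! ### Bounds for the pieces, in the functional `T` -/

/-- `‖μ(n) χ_r(n)‖ ≤ 1`. [folklore] -/
theorem norm_moebius_mul_copChar_le (r : ℕ) {q : ℕ} (χ : DirichletCharacter ℂ q) (n : ℕ) :
    ‖(μ n : ℂ) * copChar r χ n‖ ≤ 1 := by
  rw [norm_mul]
  have h1 : ‖(μ n : ℂ)‖ ≤ 1 := by
    rw [Complex.norm_intCast, ← Int.cast_abs]; exact_mod_cast abs_moebius_le_one
  exact mul_le_one₀ h1 (norm_nonneg _) (norm_copChar_le r χ n)

/-- `‖2 P₀‖ ≤ 2U`. [folklore] -/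
theorem norm_two_mul_P₀_le (r U X : ℕ) {q : ℕ} (χ : DirichletCharacter ℂ q) :
    ‖2 * P₀ r U X χ‖ ≤ 2 * U := by
  rw [norm_mul, Complex.norm_two]
  refine mul_le_mul_of_nonneg_left ?_ (by norm_num)
  unfold P₀
  refine (norm_sum_le _ _).trans ?_
  calc ∑ n ∈ Ioc 0 (min U X), ‖(μ n : ℂ) * copChar r χ n‖ ≤ ∑ n ∈ Ioc 0 (min U X), (1 : ℝ) :=
        sum_le_sum fun n _ => norm_moebius_mul_copChar_le r χ n
    _ = ((min U X : ℕ) : ℝ) := by simp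
    _ ≤ U := by exact_mod_cast min_le_left U X

/-- **The piece `2P₀`**: `T(2P₀) ≤ 2 U Q²`. [folklore] -/
theorem Tfun_two_mul_P₀_le (Q r U : ℕ) (X : (q : ℕ) → DirichletCharacter ℂ q → ℕ) :
    Tfun Q (fun q χ => 2 * P₀ r U (X q χ) χ) ≤ 2 * U * (Q : ℝ) ^ 2 := by
  refine (Tfun_le_of_forall_le (g := fun _ => 2 * (U : ℝ)) (fun q _ _ => by positivity)
    (fun q _ _ χ _ => norm_two_mul_P₀_le r U (X q χ) χ)).trans ?_
  calc ∑ q ∈ Icc 1 Q, (q : ℝ) * (2 * (U : ℝ))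
      ≤ ∑ q ∈ Icc 1 Q, (Q : ℝ) * (2 * (U : ℝ)) := by
        refine sum_le_sum fun q hq => ?_
        rw [mem_Icc] at hq
        exact mul_le_mul_of_nonneg_right (by exact_mod_cast hq.2) (by positivity)
    _ = Q * (Q * (2 * U)) := by simp
    _ = _ := by ring

/-- Pointwise truncation of `T₂'`: `‖T₂'‖ ≤ ∑_{d ≤ U} τ(d) ‖∑_{m ≤ X/d} χ_r(m)‖`. [folklore] -/
theorem norm_T₂'_le (r U X : ℕ) {q : ℕ} (χ : DirichletCharacter ℂ q) :
    ‖T₂' r U X χ‖ ≤ ∑ d ∈ Ioc 0 U, (#d.divisors : ℝ) * ‖∑ m ∈ Ioc 0 (X / d), copChar r χ m‖ := by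
  unfold T₂'
  refine (norm_sum_le _ _).trans ?_
  calc ∑ d ∈ Ioc 0 (min U X), ‖(mumu U d : ℂ) * copChar r χ d * ∑ m ∈ Ioc 0 (X / d), copChar r χ m‖
      ≤ ∑ d ∈ Ioc 0 (min U X), (#d.divisors : ℝ) * ‖∑ m ∈ Ioc 0 (X / d), copChar r χ m‖ := by
        refine sum_le_sum fun d _ => ?_
        rw [norm_mul, norm_mul, Complex.norm_real, Real.norm_eq_abs]
        refine mul_le_mul ?_ le_rfl (norm_nonneg _) (Nat.cast_nonneg _)
        calc |mumu U d| * ‖copChar r χ d‖ ≤ (#d.divisors : ℝ) * 1 :=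
              mul_le_mul (abs_mumu_le U d) (norm_copChar_le r χ d) (norm_nonneg _) (Nat.cast_nonneg _)
          _ = _ := mul_one _
    _ ≤ _ := sum_le_sum_of_subset_of_nonneg (Ioc_subset_Ioc_right (min_le_left U X))
          fun _ _ _ => mul_nonneg (Nat.cast_nonneg _) (norm_nonneg _)

/-- The trivial bound `‖T₂'‖ ≤ Y₀ ℓ²` for `X, U ≤ Y₀` (any `χ`; used for `q = 1`). [folklore] -/
theorem norm_T₂'_le_trivial {r U X Y₀ : ℕ} (hX : X ≤ Y₀) (hU : U ≤ Y₀) {q : ℕ}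
    (χ : DirichletCharacter ℂ q) : ‖T₂' r U X χ‖ ≤ Y₀ * ell Y₀ ^ 2 := by
  refine (norm_T₂'_le r U X χ).trans ?_
  have hℓ := ell_nonneg Y₀
  have hlogU : 1 + Real.log U ≤ ell Y₀ := one_add_log_le_ell hU
  have hlogU0 : 0 ≤ 1 + Real.log U := by have := Real.log_natCast_nonneg U; linarith
  calc ∑ d ∈ Ioc 0 U, (#d.divisors : ℝ) * ‖∑ m ∈ Ioc 0 (X / d), copChar r χ m‖
      ≤ ∑ d ∈ Ioc 0 U, (#d.divisors : ℝ) * ((Y₀ : ℝ) / d) := by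
        refine sum_le_sum fun d hd => mul_le_mul_of_nonneg_left ?_ (Nat.cast_nonneg _)
        rw [mem_Ioc] at hd
        refine (norm_sum_le _ _).trans ?_
        calc ∑ m ∈ Ioc 0 (X / d), ‖copChar r χ m‖ ≤ ∑ m ∈ Ioc 0 (X / d), (1 : ℝ) :=
              sum_le_sum fun m _ => norm_copChar_le r χ m
          _ = ((X / d : ℕ) : ℝ) := by simp
          _ ≤ (X : ℝ) / d := Nat.cast_div_le
          _ ≤ (Y₀ : ℝ) / d := div_le_div_of_nonneg_right (by exact_mod_cast hX) (Nat.cast_nonneg d)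
    _ = Y₀ * ∑ d ∈ Ioc 0 U, (#d.divisors : ℝ) / d := by
        rw [mul_sum]; exact sum_congr rfl fun d _ => by ring
    _ ≤ Y₀ * (1 + Real.log U) ^ 2 :=
        mul_le_mul_of_nonneg_left (sum_card_divisors_div_le U) (Nat.cast_nonneg _)
    _ ≤ Y₀ * ell Y₀ ^ 2 :=
        mul_le_mul_of_nonneg_left (pow_le_pow_left₀ hlogU0 hlogU 2) (Nat.cast_nonneg _)

/-- For primitive `χ mod q ≥ 2` and `r ≠ 0`: `‖T₂'‖ ≤ τ(r) U ℓ √q (1 + log q)` (Pólya–Vinogradov with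
the coprimality condition). [folklore] -/
theorem norm_T₂'_le_of_isPrimitive {r U X Y₀ : ℕ} (hr : r ≠ 0) (hU : U ≤ Y₀) {q : ℕ} (hq : 2 ≤ q)
    {χ : DirichletCharacter ℂ q} (hχ : χ.IsPrimitive) :
    ‖T₂' r U X χ‖ ≤ (σ 0 r : ℝ) * U * ell Y₀ * (Real.sqrt q * (1 + Real.log q)) := by
  refine (norm_T₂'_le r U X χ).trans ?_
  have hlq : 0 ≤ Real.log q := Real.log_natCast_nonneg q
  have hP : 0 ≤ Real.sqrt q * (1 + Real.log q) := by positivity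
  have hσ : (0 : ℝ) ≤ σ 0 r := Nat.cast_nonneg _
  have hlogU : 1 + Real.log U ≤ ell Y₀ := one_add_log_le_ell hU
  have hlogU0 : 0 ≤ 1 + Real.log U := by have := Real.log_natCast_nonneg U; linarith
  calc ∑ d ∈ Ioc 0 U, (#d.divisors : ℝ) * ‖∑ m ∈ Ioc 0 (X / d), copChar r χ m‖
      ≤ ∑ d ∈ Ioc 0 U, (#d.divisors : ℝ) * ((σ 0 r : ℝ) * (Real.sqrt q * (1 + Real.log q))) :=
        sum_le_sum fun d _ => mul_le_mul_of_nonneg_left (norm_sum_copChar_le hr hq hχ _)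
          (Nat.cast_nonneg _)
    _ = (∑ d ∈ Ioc 0 U, (#d.divisors : ℝ)) * ((σ 0 r : ℝ) * (Real.sqrt q * (1 + Real.log q))) := by
        rw [sum_mul]
    _ ≤ (U * (1 + Real.log U)) * ((σ 0 r : ℝ) * (Real.sqrt q * (1 + Real.log q))) :=
        mul_le_mul_of_nonneg_right (sum_card_divisors_le U) (by positivity)
    _ ≤ (U * ell Y₀) * ((σ 0 r : ℝ) * (Real.sqrt q * (1 + Real.log q))) :=
        mul_le_mul_of_nonneg_right (mul_le_mul_of_nonneg_left hlogU (Nat.cast_nonneg _))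
          (by positivity)
    _ = _ := by ring

/-- **The piece `T₂'`**: `T(T₂') ≤ Y₀ ℓ² + τ(r) U ℓ Q^{5/2} (1 + log Q)`. [folklore] -/
theorem Tfun_T₂'_le {Q r U Y₀ : ℕ} (hQ : 1 ≤ Q) (hr : r ≠ 0) (hU : U ≤ Y₀)
    (X : (q : ℕ) → DirichletCharacter ℂ q → ℕ) (hX : ∀ q χ, X q χ ≤ Y₀) :
    Tfun Q (fun q χ => T₂' r U (X q χ) χ) ≤
      Y₀ * ell Y₀ ^ 2 +
        (σ 0 r : ℝ) * U * ell Y₀ * ((Q : ℝ) ^ 2 * Real.sqrt Q * (1 + Real.log Q)) :=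
  Tfun_le_of_le_one_of_le hQ (by have := ell_nonneg Y₀; positivity)
    (by have := ell_nonneg Y₀; positivity)
    (fun χ => norm_T₂'_le_trivial (hX 1 χ) hU χ)
    (fun q hq _ χ hχ => norm_T₂'_le_of_isPrimitive (X := X q χ) hr hU hq hχ)

/-- `√(16 M ℓ³ · N) ≤ 4 ℓ² √Y₀` when `M N ≤ Y₀` (the mean squares of a block). [folklore] -/
theorem sqrt_blockConst_le {M N Y₀ : ℕ} (hMN : M * N ≤ Y₀) :
    Real.sqrt (16 * M * ell Y₀ ^ 3 * N) ≤ 4 * ell Y₀ ^ 2 * Real.sqrt Y₀ := by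
  have hℓ := ell_nonneg Y₀
  have hℓ1 := one_le_ell Y₀
  rw [Real.sqrt_le_left (by positivity)]
  have hMN' : (M : ℝ) * N ≤ Y₀ := by exact_mod_cast hMN
  have hY : Real.sqrt Y₀ ^ 2 = Y₀ := Real.sq_sqrt (Nat.cast_nonneg Y₀)
  have h3 : ell Y₀ ^ 3 ≤ ell Y₀ ^ 4 := pow_le_pow_right₀ hℓ1 (by norm_num)
  have h4 : 0 ≤ ell Y₀ ^ 4 := pow_nonneg hℓ 4
  have hMN0 : (0 : ℝ) ≤ M * N := by positivity
  calc 16 * (M : ℝ) * ell Y₀ ^ 3 * N = 16 * ((M : ℝ) * N) * ell Y₀ ^ 3 := by ring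
    _ ≤ 16 * (Y₀ : ℝ) * ell Y₀ ^ 4 := by
        nlinarith [mul_le_mul hMN' h3 (pow_nonneg hℓ 3) (Nat.cast_nonneg _)]
    _ = (4 * ell Y₀ ^ 2 * Real.sqrt Y₀) ^ 2 := by rw [mul_pow, mul_pow, hY]; ring

/-- **The piece `T₂''`**: `T(T₂'') ≤ 160 ℓ⁴ √Y₀ (√Y₀ + UQ + Q √Y₀/√U + Q²)` for `U² ≤ Y₀`
(dyadic blocks and the hyperbolic large sieve, as for Vaughan's `S₂''`). [folklore] -/
theorem Tfun_T₂''_le {Q r U Y₀ : ℕ} (hU : 1 ≤ U) (hUU : U * U ≤ Y₀)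
    (X : (q : ℕ) → DirichletCharacter ℂ q → ℕ) (hX : ∀ q χ, X q χ ≤ Y₀) :
    Tfun Q (fun q χ => T₂'' r U (X q χ) χ) ≤
      160 * ell Y₀ ^ 4 * (Real.sqrt Y₀ *
        (Real.sqrt Y₀ + U * Q + Q * (Real.sqrt Y₀ / Real.sqrt U) + (Q : ℝ) ^ 2)) := by
  have hℓ := ell_nonneg Y₀
  obtain ⟨J, hJY, hJℓ⟩ := exists_dyadic_range hU Y₀
  set G : ℝ := 80 * ell Y₀ ^ 3 * (Real.sqrt Y₀ *
    (Real.sqrt Y₀ + U * Q + Q * (Real.sqrt Y₀ / Real.sqrt U) + (Q : ℝ) ^ 2)) with hG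
  have hG0 : 0 ≤ G := by positivity
  have hblock : ∀ i ∈ range J,
      Tfun Q (fun q χ => blockSum (copCoeff r (mumu U)) (copCoeff r fun _ => 1) (U * 2 ^ i)
        (X q χ) χ) ≤ G := by
    intro i _
    have hUM : U ≤ U * 2 ^ i := Nat.le_mul_of_pos_right U (Nat.two_pow_pos i)
    have hM1 : 1 ≤ U * 2 ^ i := hU.trans hUM
    rcases le_or_gt (U * U) (U * 2 ^ i) with hz | hlt
    · rw [Tfun_eq_zero_of_forall fun q _ _ χ => blockSum_mumu_eq_zero hz _ χ]
      exact hG0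
    · have hMY : U * 2 ^ i ≤ Y₀ := hlt.le.trans hUU
      have hA0 : (0 : ℝ) ≤ 16 * (U * 2 ^ i : ℕ) * ell Y₀ ^ 3 := by positivity
      refine (Tfun_blockSum_le (copCoeff r (mumu U)) (copCoeff r fun _ => 1) hM1 hMY X hX hA0
        (sum_sq_copCoeff_mumu_le r hMY) (sum_sq_copCoeff_one_le r _)).trans ?_
      have hsM : Real.sqrt (U * 2 ^ i : ℕ) ≤ U := sqrt_le_of_lt_mul_self hlt
      have hsN : Real.sqrt (Y₀ / (U * 2 ^ i) : ℕ) ≤ Real.sqrt Y₀ / Real.sqrt U :=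
        sqrt_div_le_sqrt_div_sqrt hU hUM
      have hAB := sqrt_blockConst_le (Y₀ := Y₀) (Nat.mul_div_le Y₀ (U * 2 ^ i))
      have hprod : (Real.sqrt (U * 2 ^ i : ℕ) + Q) * (Real.sqrt (Y₀ / (U * 2 ^ i) : ℕ) + Q) ≤
          Real.sqrt Y₀ + U * Q + Q * (Real.sqrt Y₀ / Real.sqrt U) + (Q : ℝ) ^ 2 := by
        have hQ0 : (0 : ℝ) ≤ Q := Nat.cast_nonneg Q
        have hsMN := sqrt_mul_sqrt_div_le (U * 2 ^ i) Y₀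
        nlinarith [mul_le_mul_of_nonneg_left hsM hQ0, mul_le_mul_of_nonneg_left hsN hQ0,
          Real.sqrt_nonneg (U * 2 ^ i : ℕ), Real.sqrt_nonneg (Y₀ / (U * 2 ^ i) : ℕ)]
      calc 20 * ell Y₀ * ((Real.sqrt (U * 2 ^ i : ℕ) + Q) *
            (Real.sqrt (Y₀ / (U * 2 ^ i) : ℕ) + Q)) *
            Real.sqrt (16 * (U * 2 ^ i : ℕ) * ell Y₀ ^ 3 * (Y₀ / (U * 2 ^ i) : ℕ))
          ≤ 20 * ell Y₀ * (Real.sqrt Y₀ + U * Q + Q * (Real.sqrt Y₀ / Real.sqrt U) + (Q : ℝ) ^ 2) *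
            (4 * ell Y₀ ^ 2 * Real.sqrt Y₀) :=
            mul_le_mul (mul_le_mul_of_nonneg_left hprod (by positivity)) hAB
              (Real.sqrt_nonneg _) (by positivity)
        _ = G := by rw [hG]; ring
  have e : (fun q (χ : DirichletCharacter ℂ q) => T₂'' r U (X q χ) χ) =
      fun q χ => ∑ i ∈ range J, blockSum (copCoeff r (mumu U)) (copCoeff r fun _ => 1)
        (U * 2 ^ i) (X q χ) χ := by
    funext q χ; exact T₂''_eq_sum_blockSum ((hX q χ).trans hJY) χ
  rw [e]
  refine (Tfun_sum_le Q (range J) fun i q χ => blockSum (copCoeff r (mumu U))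
    (copCoeff r fun _ => 1) (U * 2 ^ i) (X q χ) χ).trans ?_
  refine (sum_le_sum hblock).trans ?_
  rw [sum_const, card_range, nsmul_eq_mul]
  calc (J : ℝ) * G ≤ 2 * ell Y₀ * G := mul_le_mul_of_nonneg_right hJℓ hG0
    _ = _ := by rw [hG]; ring

/-- **The piece `T₃`**: `T(T₃) ≤ 160 ℓ⁴ √Y₀ (√Y₀ + 2Q √Y₀/√U + Q²)` (dyadic blocks and the
hyperbolic large sieve, as for Vaughan's `S₃`). [folklore] -/
theorem Tfun_T₃_le {Q r U Y₀ : ℕ} (hU : 1 ≤ U)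
    (X : (q : ℕ) → DirichletCharacter ℂ q → ℕ) (hX : ∀ q χ, X q χ ≤ Y₀) :
    Tfun Q (fun q χ => T₃ r U (X q χ) χ) ≤
      160 * ell Y₀ ^ 4 * (Real.sqrt Y₀ *
        (Real.sqrt Y₀ + 2 * Q * (Real.sqrt Y₀ / Real.sqrt U) + (Q : ℝ) ^ 2)) := by
  have hℓ := ell_nonneg Y₀
  obtain ⟨J, hJY, hJℓ⟩ := exists_dyadic_range hU Y₀
  set G : ℝ := 80 * ell Y₀ ^ 3 * (Real.sqrt Y₀ *
    (Real.sqrt Y₀ + 2 * Q * (Real.sqrt Y₀ / Real.sqrt U) + (Q : ℝ) ^ 2)) with hG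
  have hG0 : 0 ≤ G := by positivity
  have hblock : ∀ i ∈ range J,
      Tfun Q (fun q χ => blockSum (copCoeff r (gU U)) (copCoeff r (muTail U)) (U * 2 ^ i)
        (X q χ) χ) ≤ G := by
    intro i _
    have hUM : U ≤ U * 2 ^ i := Nat.le_mul_of_pos_right U (Nat.two_pow_pos i)
    have hM1 : 1 ≤ U * 2 ^ i := hU.trans hUM
    rcases le_or_gt Y₀ (U * (U * 2 ^ i)) with hz | hlt
    · rw [Tfun_eq_zero_of_forall fun q _ _ χ => blockSum_gU_muTail_eq_zero (hX q χ) hz χ]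
      exact hG0
    · have hMY : U * 2 ^ i ≤ Y₀ := le_trans (Nat.le_mul_of_pos_left _ hU) hlt.le
      have hA0 : (0 : ℝ) ≤ 16 * (U * 2 ^ i : ℕ) * ell Y₀ ^ 3 := by positivity
      refine (Tfun_blockSum_le (copCoeff r (gU U)) (copCoeff r (muTail U)) hM1 hMY X hX hA0
        (sum_sq_copCoeff_gU_le r hMY) (sum_sq_copCoeff_muTail_le r U _)).trans ?_
      have hsM : Real.sqrt (U * 2 ^ i : ℕ) ≤ Real.sqrt Y₀ / Real.sqrt U :=
        sqrt_le_sqrt_div_sqrt hU hlt.le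
      have hsN : Real.sqrt (Y₀ / (U * 2 ^ i) : ℕ) ≤ Real.sqrt Y₀ / Real.sqrt U :=
        sqrt_div_le_sqrt_div_sqrt hU hUM
      have hAB := sqrt_blockConst_le (Y₀ := Y₀) (Nat.mul_div_le Y₀ (U * 2 ^ i))
      have hprod : (Real.sqrt (U * 2 ^ i : ℕ) + Q) * (Real.sqrt (Y₀ / (U * 2 ^ i) : ℕ) + Q) ≤
          Real.sqrt Y₀ + 2 * Q * (Real.sqrt Y₀ / Real.sqrt U) + (Q : ℝ) ^ 2 := by
        have hQ0 : (0 : ℝ) ≤ Q := Nat.cast_nonneg Q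
        have hsMN := sqrt_mul_sqrt_div_le (U * 2 ^ i) Y₀
        nlinarith [mul_le_mul_of_nonneg_left hsM hQ0, mul_le_mul_of_nonneg_left hsN hQ0,
          Real.sqrt_nonneg (U * 2 ^ i : ℕ), Real.sqrt_nonneg (Y₀ / (U * 2 ^ i) : ℕ)]
      calc 20 * ell Y₀ * ((Real.sqrt (U * 2 ^ i : ℕ) + Q) *
            (Real.sqrt (Y₀ / (U * 2 ^ i) : ℕ) + Q)) *
            Real.sqrt (16 * (U * 2 ^ i : ℕ) * ell Y₀ ^ 3 * (Y₀ / (U * 2 ^ i) : ℕ))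
          ≤ 20 * ell Y₀ * (Real.sqrt Y₀ + 2 * Q * (Real.sqrt Y₀ / Real.sqrt U) + (Q : ℝ) ^ 2) *
            (4 * ell Y₀ ^ 2 * Real.sqrt Y₀) :=
            mul_le_mul (mul_le_mul_of_nonneg_left hprod (by positivity)) hAB
              (Real.sqrt_nonneg _) (by positivity)
        _ = G := by rw [hG]; ring
  have e : (fun q (χ : DirichletCharacter ℂ q) => T₃ r U (X q χ) χ) =
      fun q χ => ∑ i ∈ range J, blockSum (copCoeff r (gU U)) (copCoeff r (muTail U))
        (U * 2 ^ i) (X q χ) χ := by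
    funext q χ; exact T₃_eq_sum_blockSum ((hX q χ).trans hJY) χ
  rw [e]
  refine (Tfun_sum_le Q (range J) fun i q χ => blockSum (copCoeff r (gU U))
    (copCoeff r (muTail U)) (U * 2 ^ i) (X q χ) χ).trans ?_
  refine (sum_le_sum hblock).trans ?_
  rw [sum_const, card_range, nsmul_eq_mul]
  calc (J : ℝ) * G ≤ 2 * ell Y₀ * G := mul_le_mul_of_nonneg_right hJℓ hG0
    _ = _ := by rw [hG]; ring

/-! ### The case `Q² > Y` -/

/-- `M_r(X, χ)` as a hyperbolic bilinear form with a single row: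
`M_r(X, χ) = ∑_{m ∈ (0,1]} ∑_{n ∈ (0,Y₀]} [mn ≤ X] 1 · (μ𝟙_r)(n) χ(mn)` for `X ≤ Y₀`. [folklore] -/
theorem moebiusCharSum_eq_sum_ite {r X Y₀ : ℕ} (hX : X ≤ Y₀) {q : ℕ} (χ : DirichletCharacter ℂ q) :
    moebiusCharSum r χ X = ∑ m ∈ Ioc 0 (0 + 1), ∑ n ∈ Ioc 0 (0 + Y₀),
      (if m * n ≤ X then (1 : ℂ) * ((copCoeff r (fun n => (μ n : ℝ)) n : ℝ) : ℂ) * χ (m * n)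
        else 0) := by
  have h := sum_Ioc_div_eq_sum_ite (fun n => (μ n : ℂ) * copChar r χ n) (d := 1) (X := X) one_pos
    (show X / 1 ≤ 0 + Y₀ by rw [Nat.div_one, zero_add]; exact hX)
  rw [Nat.div_one] at h
  rw [Nat.Ioc_succ_singleton, sum_singleton, moebiusCharSum, h]
  refine sum_congr rfl fun n _ => ?_
  simp only [one_mul, copCoeff_apply, copChar_eq]
  push_cast; ring_nf

/-- **The case `Q² > Y₀`**: `T(M_r) ≤ 20 Q² √Y₀ ℓ` (the hyperbolic large sieve with one row).
[folklore] -/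
theorem Tfun_moebiusCharSum_le_of_lt_sq {Q r Y₀ : ℕ} (hY : 1 ≤ Y₀) (hQY : Y₀ + 1 ≤ Q * Q)
    (X : (q : ℕ) → DirichletCharacter ℂ q → ℕ) (hX : ∀ q χ, X q χ ≤ Y₀) :
    Tfun Q (fun q χ => moebiusCharSum r χ (X q χ)) ≤ 20 * (Q : ℝ) ^ 2 * Real.sqrt Y₀ * ell Y₀ := by
  classical
  set b : ℕ → ℝ := copCoeff r (fun n => (μ n : ℝ)) with hb
  have h : ∑ q ∈ Icc 1 Q, (q : ℝ) / q.totient *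
      ∑ χ : DirichletCharacter ℂ q with χ.IsPrimitive,
        ‖∑ m ∈ Ioc 0 (0 + 1), ∑ n ∈ Ioc 0 (0 + Y₀),
          (if m * n ≤ X q χ then (1 : ℂ) * ((b n : ℝ) : ℂ) * χ (m * n) else 0)‖ ≤
      (2 + Real.log (sepModulus (4 * (Y₀ + 1)) (0 + 1) (0 + Y₀))) *
        (Real.sqrt ((((1 : ℕ) : ℝ) + 1 + 2 * (Q : ℝ) ^ 2) *
            ∑ m ∈ Ioc 0 (0 + 1), ‖(1 : ℂ)‖ ^ 2) *
          Real.sqrt (((Y₀ : ℝ) + 1 + 2 * (Q : ℝ) ^ 2) *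
            ∑ n ∈ Ioc 0 (0 + Y₀), ‖((b n : ℝ) : ℂ)‖ ^ 2)) :=
    largeSieve_bilinear_hyperbolic (fun _ => (1 : ℂ)) (fun n => ((b n : ℝ) : ℂ)) 0 1 0 Y₀ Q Y₀
      X hX
  have e : (fun q (χ : DirichletCharacter ℂ q) => moebiusCharSum r χ (X q χ)) = fun q χ =>
      ∑ m ∈ Ioc 0 (0 + 1), ∑ n ∈ Ioc 0 (0 + Y₀),
        (if m * n ≤ X q χ then (1 : ℂ) * ((b n : ℝ) : ℂ) * χ (m * n) else 0) := by
    funext q χ; exact moebiusCharSum_eq_sum_ite (hX q χ) χ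
  rw [e]
  unfold Tfun
  refine h.trans ?_
  have h1 : ∑ m ∈ Ioc 0 (0 + 1), ‖(1 : ℂ)‖ ^ 2 = 1 := by simp
  have h2 : ∑ n ∈ Ioc 0 (0 + Y₀), ‖((b n : ℝ) : ℂ)‖ ^ 2 = ∑ n ∈ Ioc 0 Y₀, b n ^ 2 := by
    rw [zero_add]; exact sum_congr rfl fun n _ => norm_ofReal_sq _
  rw [h1, h2, zero_add, zero_add, Nat.cast_one, mul_one]
  have hℓ := ell_nonneg Y₀
  have hℓ1 := one_le_ell Y₀
  have hlog : 2 + Real.log (sepModulus (4 * (Y₀ + 1)) 1 Y₀) ≤ 5 * ell Y₀ :=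
    two_add_log_sepModulus_le hY le_rfl hY (by omega)
  have hQ : (Y₀ : ℝ) + 1 ≤ (Q : ℝ) ^ 2 := by rw [sq]; exact_mod_cast hQY
  have hs1 : Real.sqrt (1 + 1 + 2 * (Q : ℝ) ^ 2) ≤ 2 * Q := by
    rw [Real.sqrt_le_left (by positivity)]
    have : (1 : ℝ) ≤ Y₀ := by exact_mod_cast hY
    nlinarith
  have hb2 : ∑ n ∈ Ioc 0 Y₀, b n ^ 2 ≤ Y₀ := by
    calc ∑ n ∈ Ioc 0 Y₀, b n ^ 2 ≤ ∑ n ∈ Ioc 0 Y₀, (1 : ℝ) := by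
          refine sum_le_sum fun n _ => ?_
          rw [hb]
          refine (copCoeff_sq_le r _ n).trans ?_
          have h := abs_moebius_le_one (n := n)
          have h' : |(μ n : ℝ)| ≤ 1 := by exact_mod_cast h
          rw [← sq_abs]; nlinarith [abs_nonneg (μ n : ℝ)]
      _ = Y₀ := by simp
  have hS0 : 0 ≤ ∑ n ∈ Ioc 0 Y₀, b n ^ 2 := sum_nonneg fun _ _ => by positivity
  have hs2 : Real.sqrt (((Y₀ : ℝ) + 1 + 2 * (Q : ℝ) ^ 2) * ∑ n ∈ Ioc 0 Y₀, b n ^ 2) ≤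
      2 * Q * Real.sqrt Y₀ := by
    rw [Real.sqrt_le_left (by positivity)]
    have hc : (Y₀ : ℝ) + 1 + 2 * (Q : ℝ) ^ 2 ≤ 3 * (Q : ℝ) ^ 2 := by linarith
    have hp := mul_le_mul hc hb2 hS0 (by positivity)
    have hY' : Real.sqrt Y₀ ^ 2 = Y₀ := Real.sq_sqrt (Nat.cast_nonneg Y₀)
    have e5 : (2 * (Q : ℝ) * Real.sqrt Y₀) ^ 2 = 4 * ((Q : ℝ) ^ 2 * Y₀) := by
      rw [mul_pow, mul_pow, hY']; ring
    rw [e5]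
    have h7 : 0 ≤ (Q : ℝ) ^ 2 * Y₀ := by positivity
    linarith
  calc _ ≤ (5 * ell Y₀) * ((2 * Q) * (2 * Q * Real.sqrt Y₀)) :=
        mul_le_mul hlog (mul_le_mul hs1 hs2 (Real.sqrt_nonneg _) (by positivity))
          (mul_nonneg (Real.sqrt_nonneg _) (Real.sqrt_nonneg _)) (by positivity)
    _ = _ := by ring

/-! ### The case `Q² ≤ Y`: all pieces together -/

/-- **The case `Q² ≤ Y₀`**: for `1 ≤ U`, `U² ≤ Y₀`, `r ≠ 0` and cut-offs `X ≤ Y₀`,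
`T(M_r) ≤ T(2P₀) + T(T₂') + T(T₂'') + T(T₃)`, each piece bounded as above. [folklore] -/
theorem Tfun_moebiusCharSum_le_pieces {Q r U Y₀ : ℕ} (hQ : 1 ≤ Q) (hr : r ≠ 0) (hU : 1 ≤ U)
    (hUU : U * U ≤ Y₀) (X : (q : ℕ) → DirichletCharacter ℂ q → ℕ) (hX : ∀ q χ, X q χ ≤ Y₀) :
    Tfun Q (fun q χ => moebiusCharSum r χ (X q χ)) ≤
      2 * U * (Q : ℝ) ^ 2 +
      (Y₀ * ell Y₀ ^ 2 +
        (σ 0 r : ℝ) * U * ell Y₀ * ((Q : ℝ) ^ 2 * Real.sqrt Q * (1 + Real.log Q))) +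
      160 * ell Y₀ ^ 4 * (Real.sqrt Y₀ *
        (Real.sqrt Y₀ + U * Q + Q * (Real.sqrt Y₀ / Real.sqrt U) + (Q : ℝ) ^ 2)) +
      160 * ell Y₀ ^ 4 * (Real.sqrt Y₀ *
        (Real.sqrt Y₀ + 2 * Q * (Real.sqrt Y₀ / Real.sqrt U) + (Q : ℝ) ^ 2)) := by
  have hUY : U ≤ Y₀ := le_trans (Nat.le_mul_of_pos_left U hU) hUU
  have e : (fun q (χ : DirichletCharacter ℂ q) => moebiusCharSum r χ (X q χ)) = fun q χ =>
      2 * P₀ r U (X q χ) χ - T₂' r U (X q χ) χ - T₂'' r U (X q χ) χ + T₃ r U (X q χ) χ := by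
    funext q χ; exact moebiusCharSum_eq_decomposition r U (X q χ) χ
  rw [e]
  have h0 := Tfun_two_mul_P₀_le Q r U X
  have h1 := Tfun_T₂'_le hQ hr hUY X hX
  have h2 := Tfun_T₂''_le (Q := Q) (r := r) hU hUU X hX
  have h3 := Tfun_T₃_le (Q := Q) (r := r) hU X hX
  have step1 := Tfun_add_le Q
    (fun q χ => 2 * P₀ r U (X q χ) χ - T₂' r U (X q χ) χ - T₂'' r U (X q χ) χ)
    (fun q χ => T₃ r U (X q χ) χ)
  have step2 := Tfun_sub_le Q
    (fun q χ => 2 * P₀ r U (X q χ) χ - T₂' r U (X q χ) χ) (fun q χ => T₂'' r U (X q χ) χ)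
  have step3 := Tfun_sub_le Q (fun q χ => 2 * P₀ r U (X q χ) χ) (fun q χ => T₂' r U (X q χ) χ)
  linarith

end Literature.NumberTheory.Sieve.VaughanMoebius

namespace Literature.NumberTheory.Sieve

open Vaughan LargeSieve VaughanMoebius
open scoped ArithmeticFunction.sigma

/-- **Vaughan's mean value theorem for the Möbius function with a coprimality condition**: for
integers `r, Q ≥ 1`, real `Y ≥ 2` and arbitrary integer cut-offs `X(q, χ) ≤ Y`,
`∑_{q ≤ Q} (q/φ(q)) ∑*_{χ mod q} |∑_{n ≤ X(q,χ), (n,r)=1} μ(n)χ(n)|`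
`   ≤ 110000 τ(r) (Y + Y^{5/6} Q + Y^{1/2} Q²) log⁴(YQ)`
— the analogue for `μ` of Vaughan's Theorem 1 (Acta Arith. 37 (1980)) for `ψ(y, χ)`, proved the
same way: Vaughan's identity for `μ` (Iwaniec–Kowalski (13.40)) with `u = min(Y^{1/3}, YQ⁻²)`,
the type I piece with `d ≤ u` by the Pólya–Vinogradov inequality (with the coprimality condition
removed by Möbius inversion over the divisors of `r`, whence the factor `τ(r)`), the remaining
pieces in dyadic blocks by the bilinear large sieve with the hyperbolic cut-off
(`Literature.NumberTheory.Sieve.LargeSieve.largeSieve_bilinear_hyperbolic`), and the case `Q² > Y`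
by the latter with a single row.  The coprimality condition `(n, r) = 1` is what the reduction of
an imprimitive character `mod qr` to the primitive `χ mod q` produces; it is needed for the
Bombieri–Vinogradov theorem for `μ`. [cite: Vaughan1980, Theorem 1 (the method; there for ψ)] -/
theorem moebius_character_meanValue (r : ℕ) (hr : r ≠ 0) (Q : ℕ) (hQ : 1 ≤ Q) (Y : ℝ)
    (hY : 2 ≤ Y) (X : (q : ℕ) → DirichletCharacter ℂ q → ℕ) (hXle : ∀ q χ, X q χ ≤ ⌊Y⌋₊) :
    Tfun Q (fun q χ => moebiusCharSum r χ (X q χ)) ≤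
      110000 * (σ 0 r : ℝ) * (Y + Y ^ (5 / 6 : ℝ) * Q + Y ^ (1 / 2 : ℝ) * (Q : ℝ) ^ 2) *
        Real.log (Y * Q) ^ 4 := by
  obtain ⟨Y₀, hY₀def⟩ : ∃ Y₀ : ℕ, Y₀ = ⌊Y⌋₊ := ⟨_, rfl⟩
  rw [← hY₀def] at hXle
  have hσ1 : (1 : ℝ) ≤ σ 0 r := by
    rw [ArithmeticFunction.sigma_zero_apply]
    exact_mod_cast Finset.card_pos.2 ⟨1, Nat.one_mem_divisors.2 hr⟩
  have hσ0 : (0 : ℝ) ≤ σ 0 r := by linarith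
  have hY1 : (1 : ℝ) ≤ Y := by linarith
  have hY0 : (0 : ℝ) ≤ Y := by linarith
  have hY₀2 : 2 ≤ Y₀ := by rw [hY₀def]; exact Nat.le_floor (by exact_mod_cast hY)
  have hY₀1 : 1 ≤ Y₀ := by omega
  have hY₀Y : (Y₀ : ℝ) ≤ Y := by rw [hY₀def]; exact Nat.floor_le hY0
  have hY₀0 : (0 : ℝ) ≤ Y₀ := Nat.cast_nonneg Y₀
  have hQ1 : (1 : ℝ) ≤ Q := by exact_mod_cast hQ
  have hQ0 : (0 : ℝ) < Q := by linarith
  -- the logarithms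
  obtain ⟨L, hLdef⟩ : ∃ L : ℝ, L = Real.log (Y * Q) := ⟨_, rfl⟩
  rw [← hLdef]
  have hL : Real.log Y ≤ L := by
    rw [hLdef]; exact Real.log_le_log (by linarith) (le_mul_of_one_le_right hY0 hQ1)
  have hlog2 : Real.log 2 ≤ Real.log Y := Real.log_le_log two_pos hY
  have h2L : 1 ≤ 2 * L := by have := Real.log_two_gt_d9; linarith
  have hL0 : 0 ≤ L := by linarith
  have hℓ : ell Y₀ ≤ 3 * L := by
    unfold ell
    have : Real.log Y₀ ≤ Real.log Y :=
      Real.log_le_log (by exact_mod_cast (by omega : 0 < Y₀)) hY₀Y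
    linarith
  have hℓ1 := one_le_ell Y₀
  have hℓ0 := ell_nonneg Y₀
  have hℓ4 : ell Y₀ ^ 4 ≤ 81 * L ^ 4 := by
    calc ell Y₀ ^ 4 ≤ (3 * L) ^ 4 := pow_le_pow_left₀ hℓ0 hℓ 4
      _ = 81 * L ^ 4 := by ring
  -- `A = Y^{1/6}`
  obtain ⟨A, hA⟩ : ∃ A : ℝ, A = Y ^ (1 / 6 : ℝ) := ⟨_, rfl⟩
  have hA0 : 0 < A := by rw [hA]; exact Real.rpow_pos_of_pos (by linarith) _
  have hApow : ∀ n : ℕ, A ^ n = Y ^ ((n : ℝ) / 6) := fun n => by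
    rw [hA, ← Real.rpow_natCast, ← Real.rpow_mul hY0]; congr 1; ring
  have hA6 : A ^ 6 = Y := by rw [hApow]; norm_num
  have hA3 : Y ^ (1 / 2 : ℝ) = A ^ 3 := by rw [hApow]; norm_num
  have hA5 : Y ^ (5 / 6 : ℝ) = A ^ 5 := by rw [hApow]; norm_num
  have hA1 : 1 ≤ A := by rw [hA]; exact Real.one_le_rpow hY1 (by norm_num)
  have hsY : Real.sqrt Y₀ ≤ A ^ 3 := by
    calc Real.sqrt Y₀ ≤ Real.sqrt Y := Real.sqrt_le_sqrt hY₀Y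
      _ = A ^ 3 := by
          rw [← hA6, show A ^ 6 = (A ^ 3) ^ 2 by ring, Real.sqrt_sq (by positivity)]
  have hsY0 : 0 ≤ Real.sqrt Y₀ := Real.sqrt_nonneg _
  rw [hA3, hA5]
  obtain ⟨S, hS⟩ : ∃ S : ℝ, S = Y + A ^ 5 * Q + A ^ 3 * (Q : ℝ) ^ 2 := ⟨_, rfl⟩
  rw [← hS]
  have hS1 : 0 ≤ A ^ 5 * Q + A ^ 3 * (Q : ℝ) ^ 2 := by positivity
  have hS2 : 0 ≤ A ^ 3 * (Q : ℝ) ^ 2 := by positivity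
  have hS0 : 0 ≤ S := by rw [hS]; positivity
  have hSL : 0 ≤ S * L ^ 4 := by positivity
  have hσSL : S * L ^ 4 ≤ (σ 0 r : ℝ) * (S * L ^ 4) := le_mul_of_one_le_left hSL hσ1
  rcases lt_or_ge Y₀ (Q * Q) with hcase | hcase
  · -- the case `Q² > Y₀`
    have hTA := Tfun_moebiusCharSum_le_of_lt_sq (r := r) hY₀1 hcase X hXle
    have h2 : L ≤ 8 * L ^ 4 := by
      have h8 : (1 : ℝ) ≤ (2 * L) ^ 3 := one_le_pow₀ h2L
      nlinarith only [mul_nonneg hL0 (by linarith only [h8] : (0 : ℝ) ≤ (2 * L) ^ 3 - 1)]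
    have h3 : Real.sqrt Y₀ * ell Y₀ ≤ A ^ 3 * (3 * L) := mul_le_mul hsY hℓ hℓ0 (by positivity)
    have h4 : 20 * (Q : ℝ) ^ 2 * Real.sqrt Y₀ * ell Y₀ ≤ 480 * (A ^ 3 * (Q : ℝ) ^ 2) * L ^ 4 := by
      have hQ2 : 0 ≤ 20 * (Q : ℝ) ^ 2 := by positivity
      have hQ3 : 0 ≤ 60 * (Q : ℝ) ^ 2 * A ^ 3 := by positivity
      nlinarith only [mul_le_mul_of_nonneg_left h3 hQ2, mul_le_mul_of_nonneg_left h2 hQ3]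
    have h5 : 0 ≤ (Y + A ^ 5 * Q) * L ^ 4 := by positivity
    calc _ ≤ _ := hTA
      _ ≤ 480 * (A ^ 3 * (Q : ℝ) ^ 2) * L ^ 4 := h4
      _ ≤ 480 * (S * L ^ 4) := by rw [hS]; nlinarith only [h5]
      _ ≤ 110000 * (σ 0 r : ℝ) * S * L ^ 4 := by nlinarith only [hσSL, hSL]
  · -- the case `Q² ≤ Y₀`: `u = min(Y^{1/3}, Y/Q²)`, `U = ⌊u⌋`
    have hQQY : (Q : ℝ) ^ 2 ≤ Y := by
      have : ((Q * Q : ℕ) : ℝ) ≤ Y₀ := by exact_mod_cast hcase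
      push_cast at this; nlinarith only [this, hY₀Y]
    obtain ⟨u, hu⟩ : ∃ u : ℝ, u = min (A ^ 2) (A ^ 6 / (Q : ℝ) ^ 2) := ⟨_, rfl⟩
    have hu1 : 1 ≤ u := by
      rw [hu]
      refine le_min (one_le_pow₀ hA1) ?_
      rw [le_div_iff₀ (by positivity), one_mul, hA6]; exact hQQY
    have hu0 : 0 ≤ u := zero_le_one.trans hu1
    obtain ⟨U, hUdef⟩ : ∃ U : ℕ, U = ⌊u⌋₊ := ⟨_, rfl⟩
    have hU1 : 1 ≤ U := by rw [hUdef]; exact (Nat.one_le_floor_iff u).2 hu1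
    have hU1' : (1 : ℝ) ≤ U := by exact_mod_cast hU1
    have hU0 : (0 : ℝ) < U := zero_lt_one.trans_le hU1'
    have hUu : (U : ℝ) ≤ u := by rw [hUdef]; exact Nat.floor_le hu0
    have huU : u ≤ 2 * U := by
      have h1 : u < U + 1 := by rw [hUdef]; exact Nat.lt_floor_add_one u
      linarith only [h1, hU1']
    have hUA2 : (U : ℝ) ≤ A ^ 2 := hUu.trans (by rw [hu]; exact min_le_left _ _)
    have hUQ : (U : ℝ) * (Q : ℝ) ^ 2 ≤ A ^ 6 := by
      have : (U : ℝ) ≤ A ^ 6 / (Q : ℝ) ^ 2 := hUu.trans (by rw [hu]; exact min_le_right _ _)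
      rwa [le_div_iff₀ (by positivity)] at this
    have hUUY₀ : U * U ≤ Y₀ := by
      rw [hY₀def]
      refine Nat.le_floor ?_
      push_cast
      have h2 : (U : ℝ) * U ≤ (U : ℝ) ^ 3 := by
        nlinarith only [mul_nonneg (mul_self_nonneg (U : ℝ)) (sub_nonneg.2 hU1')]
      have h3 : (U : ℝ) ^ 3 ≤ (A ^ 2) ^ 3 := pow_le_pow_left₀ (by positivity) hUA2 3
      calc (U : ℝ) * U ≤ (U : ℝ) ^ 3 := h2
        _ ≤ (A ^ 2) ^ 3 := h3
        _ = Y := by rw [← hA6]; ring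
    have hTB := Tfun_moebiusCharSum_le_pieces hQ hr hU1 hUUY₀ X hXle
    -- the elementary quantities
    have hsU0 : 0 < Real.sqrt U := Real.sqrt_pos.2 hU0
    have hsU : Real.sqrt U ^ 2 = U := Real.sq_sqrt (Nat.cast_nonneg U)
    have hsQ : Real.sqrt Q ^ 2 = Q := Real.sq_sqrt (Nat.cast_nonneg Q)
    have hsQ0 : 0 ≤ Real.sqrt Q := Real.sqrt_nonneg _
    have hlQ : 1 + Real.log Q ≤ ell Y₀ :=
      one_add_log_le_ell (le_trans (Nat.le_mul_of_pos_left Q hQ) hcase)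
    have hlQ0 : 0 ≤ 1 + Real.log (Q : ℝ) := by
      have := Real.log_natCast_nonneg Q; linarith
    -- piece 0
    have s0 : 2 * (U : ℝ) * (Q : ℝ) ^ 2 ≤ 2 * Y := by nlinarith only [hUQ, hA6]
    -- piece 1: `U Q^{3/2} ≤ Y^{5/6}`
    have s2 : (U : ℝ) * Q * Real.sqrt Q ≤ A ^ 5 := by
      have hV0 : 0 ≤ (U : ℝ) * Q * Real.sqrt Q := by positivity
      refine (pow_le_pow_iff_left₀ hV0 (by positivity) (by norm_num : (4 : ℕ) ≠ 0)).1 ?_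
      calc ((U : ℝ) * Q * Real.sqrt Q) ^ 4 = (U : ℝ) * ((U : ℝ) * (Q : ℝ) ^ 2) ^ 3 := by
            rw [show ((U : ℝ) * Q * Real.sqrt Q) ^ 4 =
              (U : ℝ) ^ 4 * (Q : ℝ) ^ 4 * (Real.sqrt Q ^ 2) ^ 2 by ring, hsQ]; ring
        _ ≤ A ^ 2 * (A ^ 6) ^ 3 :=
            mul_le_mul hUA2 (pow_le_pow_left₀ (by positivity) hUQ 3) (by positivity)
              (by positivity)
        _ = (A ^ 5) ^ 4 := by ring
    have s1 : (Y₀ * ell Y₀ ^ 2 +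
        (σ 0 r : ℝ) * U * ell Y₀ * ((Q : ℝ) ^ 2 * Real.sqrt Q * (1 + Real.log Q)))
        ≤ ell Y₀ ^ 2 * (Y + (σ 0 r : ℝ) * (A ^ 5 * Q)) := by
      have h1 : (Y₀ : ℝ) * ell Y₀ ^ 2 ≤ Y * ell Y₀ ^ 2 :=
        mul_le_mul_of_nonneg_right hY₀Y (by positivity)
      have h2 : (U : ℝ) * ell Y₀ * ((Q : ℝ) ^ 2 * Real.sqrt Q * (1 + Real.log Q)) ≤
          ell Y₀ ^ 2 * (A ^ 5 * Q) := by
        calc (U : ℝ) * ell Y₀ * ((Q : ℝ) ^ 2 * Real.sqrt Q * (1 + Real.log Q))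
            = ell Y₀ * Q * ((1 + Real.log Q) * ((U : ℝ) * Q * Real.sqrt Q)) := by ring
          _ ≤ ell Y₀ * Q * (ell Y₀ * A ^ 5) :=
              mul_le_mul_of_nonneg_left (mul_le_mul hlQ s2 (by positivity) hℓ0) (by positivity)
          _ = _ := by ring
      have h2' := mul_le_mul_of_nonneg_left h2 hσ0
      nlinarith only [h1, h2']
    -- pieces 2 and 3
    have s4 : Real.sqrt Y₀ * U * Q ≤ A ^ 5 * Q := by
      have := mul_le_mul hsY hUA2 (by positivity) (by positivity)
      nlinarith only [this, hQ0.le]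
    have s5 : (Q : ℝ) * (Real.sqrt Y₀ * (Real.sqrt Y₀ / Real.sqrt U)) ≤
        2 * (A ^ 5 * Q + A ^ 3 * (Q : ℝ) ^ 2) := by
      refine alg_W hA0 hQ1 hu huU (by positivity) ?_
      have e1 : Real.sqrt Y₀ * (Real.sqrt Y₀ / Real.sqrt U) = Y₀ / Real.sqrt U := by
        rw [← mul_div_assoc, Real.mul_self_sqrt hY₀0]
      rw [e1, div_pow, hsU, div_mul_cancel₀ _ hU0.ne']
      calc (Y₀ : ℝ) ^ 2 ≤ Y ^ 2 := pow_le_pow_left₀ hY₀0 hY₀Y 2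
        _ = A ^ 12 := by rw [← hA6]; ring
    have s6 : Real.sqrt Y₀ * (Q : ℝ) ^ 2 ≤ A ^ 3 * (Q : ℝ) ^ 2 :=
      mul_le_mul_of_nonneg_right hsY (by positivity)
    have s3 : Real.sqrt Y₀ * Real.sqrt Y₀ ≤ Y := by rw [Real.mul_self_sqrt hY₀0]; exact hY₀Y
    have hb2 : Real.sqrt Y₀ *
        (Real.sqrt Y₀ + U * Q + Q * (Real.sqrt Y₀ / Real.sqrt U) + (Q : ℝ) ^ 2) ≤ 3 * S := by
      rw [hS]; nlinarith only [s3, s4, s5, s6, hY0, hS1, hS2]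
    have hb3 : Real.sqrt Y₀ *
        (Real.sqrt Y₀ + 2 * Q * (Real.sqrt Y₀ / Real.sqrt U) + (Q : ℝ) ^ 2) ≤ 5 * S := by
      have hS3 : 0 ≤ A ^ 5 * (Q : ℝ) := by positivity
      rw [hS]; nlinarith only [s3, s5, s6, hY0, hS1, hS2, hS3]
    have hb2' := mul_le_mul_of_nonneg_left hb2 (by positivity : (0 : ℝ) ≤ 160 * ell Y₀ ^ 4)
    have hb3' := mul_le_mul_of_nonneg_left hb3 (by positivity : (0 : ℝ) ≤ 160 * ell Y₀ ^ 4)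
    -- collecting
    have hYS : Y ≤ S := by rw [hS]; linarith
    have hYAS : Y + (σ 0 r : ℝ) * (A ^ 5 * Q) ≤ (σ 0 r : ℝ) * S := by
      rw [hS]
      have : Y ≤ (σ 0 r : ℝ) * Y := le_mul_of_one_le_left hY0 hσ1
      nlinarith only [this, hS2, hσ0]
    have hp2 : ell Y₀ ^ 2 ≤ ell Y₀ ^ 4 := pow_le_pow_right₀ hℓ1 (by norm_num)
    have hp0 : 1 ≤ ell Y₀ ^ 4 := one_le_pow₀ hℓ1
    have hσS : S ≤ (σ 0 r : ℝ) * S := le_mul_of_one_le_left hS0 hσ1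
    have hσS0 : 0 ≤ (σ 0 r : ℝ) * S := by positivity
    have k1 := mul_le_mul_of_nonneg_left hYAS (by positivity : (0 : ℝ) ≤ ell Y₀ ^ 2)
    have k2 := mul_le_mul_of_nonneg_right hp2 hσS0
    have k4 := mul_le_mul_of_nonneg_right hp0 hσS0
    have k5 := mul_le_mul_of_nonneg_right hℓ4 hσS0
    have k6 := mul_le_mul_of_nonneg_left hσS (by positivity : (0 : ℝ) ≤ ell Y₀ ^ 4)
    calc _ ≤ _ := hTB
      _ ≤ 2 * Y + ell Y₀ ^ 2 * (Y + (σ 0 r : ℝ) * (A ^ 5 * Q)) + 160 * ell Y₀ ^ 4 * (3 * S) +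
          160 * ell Y₀ ^ 4 * (5 * S) := by linarith only [hTB, s0, s1, hb2', hb3']
      _ ≤ 1283 * (ell Y₀ ^ 4 * ((σ 0 r : ℝ) * S)) := by
          nlinarith only [hYS, hσS, k1, k2, k4, k6, hσS0, hS0]
      _ ≤ 110000 * (σ 0 r : ℝ) * S * L ^ 4 := by nlinarith only [k5, hσS0, hL0, hSL, hσSL]

end Literature.NumberTheory.Sieve
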